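import Summits.ResolutionOfSingularities.ResolutionOfSingularities.Theorems.PurelyInseparableDim4ResConeLayer
import HarnessLib
import HarnessLib.Audit.Tags

/-!
# Purely inseparable four-folds — THE FULL POLAR KERNEL (`e_G = 4`) FORCES `p ∣ d`: the `e_G = 4` slice of
# K2(p) sits at shade `d = p` exactly (every prime)

[OURS · counted 0 · cell `res-dim4-pi` · seat res-dim4-p-12 g2 · K2(p) lane (desk WORD #66 (2)).]  Nothing
here proves K2(p), `NoIsolatedTrap p p` or resolution of singularities in dimension ≥ 4 / characteristic `p`.

If the polar kernel `resVertex s = additiveSubspace (resForm s)` is everything, all first partial derivatives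
of the residual cone `g = resForm s` vanish (`pderiv_resForm_eq_zero_of_resVertex_eq_top`); in characteristic
`p` a polynomial with `∂_i g = 0` has all its `x_i`-exponents divisible by `p`
(`natCast_apply_eq_zero_of_pderiv_eq_zero`, Mathlib `MvPolynomial.coeff_pderiv`), so `g ∈ K[x₀^p, …, x₃^p]`
and `p` divides `deg g = d = o − |r|` (**`dvd_shade_of_resVertex_eq_top`**).  In the located residue of K2(p)
(`…ResConeResidue`: `1 ≤ d ≤ 2p − 2`) this pins the `e_G = 4` slice to `d = p` (`eq_of_dvd_of_band`).
bears_on: LADDER-RESOLUTION:D157-DOOR2 (res-dim4-pi · K2(p)).  Supports stmt-ResolutionOfSingularities-16155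
(helper).
-/

set_option linter.dupNamespace false -- mandated namespace of this single-conjunct summit

noncomputable section

namespace Summit.ResolutionOfSingularities.ResolutionOfSingularities.Theorems.PIDim4

namespace ResCone

open MvPolynomial Finset
open Literature.AlgebraicGeometry.Resolution
open Literature.AlgebraicGeometry.Resolution.CentreBlowup
open Literature.AlgebraicGeometry.Resolution.Hauser2010
open Literature.AlgebraicGeometry.Resolution.HauserPerlega2019
open PointBlowup (polarMap additiveSubspace direction)

variable {K : Type} [Field K]

/-- The polar along the basis vector `e_i` is `∂_i`. [folklore] -/
theorem polarMap_single (Φ : MvPolynomial (Fin 4) K) (i : Fin 4) :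
    polarMap Φ (Pi.single i 1) = pderiv i Φ := by
  rw [NarrowApolarity.polarMap_apply,
    Finset.sum_eq_single i (fun k _ hki => by rw [Pi.single_eq_of_ne hki, zero_smul])
      (fun h => absurd (Finset.mem_univ i) h),
    Pi.single_eq_same, one_smul]

/-- **Full polar kernel ⇒ all first partials of the residual cone vanish.** [folklore] -/
theorem pderiv_resForm_eq_zero_of_resVertex_eq_top {s : State K} (h : resVertex s = ⊤) (i : Fin 4) :
    pderiv i (resForm s) = 0 := by
  have hmem : (Pi.single i 1 : Fin 4 → K) ∈ resVertex s := by rw [h]; exact Submodule.mem_top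
  unfold resVertex additiveSubspace at hmem
  rw [LinearMap.mem_ker, polarMap_single] at hmem
  exact hmem

/-- `∂_i g = 0` ⇒ every `x_i`-exponent of `g` vanishes IN `K` (i.e. is divisible by the characteristic).
[folklore] -/
theorem natCast_apply_eq_zero_of_pderiv_eq_zero {g : MvPolynomial (Fin 4) K} {i : Fin 4}
    (h : pderiv i g = 0) {e : Fin 4 →₀ ℕ} (he : e ∈ g.support) : ((e i : ℕ) : K) = 0 := by
  by_cases hei : e i = 0
  · rw [hei, Nat.cast_zero]
  · obtain ⟨m, hm⟩ := Nat.exists_eq_succ_of_ne_zero hei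
    have hle : Finsupp.single i 1 ≤ e := Finsupp.single_le_iff.mpr (by rw [hm]; exact Nat.succ_pos m)
    have hc := coeff_pderiv g (e - Finsupp.single i 1) (i := i)
    rw [h, coeff_zero, tsub_add_cancel_of_le hle, Finsupp.tsub_apply, Finsupp.single_eq_same, hm,
      Nat.succ_sub_one] at hc
    have hne : coeff e g ≠ 0 := MvPolynomial.mem_support_iff.mp he
    have hm1 : (m : K) + 1 = 0 := by
      rcases mul_eq_zero.mp hc.symm with h0 | h0
      · exact absurd h0 hne
      · exact h0
    rw [hm, Nat.succ_eq_add_one, Nat.cast_succ]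
    exact hm1

/-- The residual cone is non-zero. [folklore] -/
theorem resForm_ne_zero {s : State K} {o : ℕ} (ho : ordZero s.F = o) (hr : ∀ d ∈ s.F.support, s.r ≤ d) :
    resForm s ≠ 0 := by
  intro h0
  have h := monomial_mul_resForm hr
  rw [h0, mul_zero] at h
  exact initialForm_ne_zero ho h.symm

/-- **`e_G = 4` forces `p ∣ d`**: if the polar kernel of the residual cone is everything then the
characteristic divides the shade `d = o − |r|`. [OURS] [folklore] -/
theorem dvd_shade_of_resVertex_eq_top (p : ℕ) [Fact p.Prime] [CharP K p] {s : State K} {o : ℕ}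
    (ho : ordZero s.F = o) (hr : ∀ d ∈ s.F.support, s.r ≤ d) (htop : resVertex s = ⊤) :
    p ∣ o - s.r.degree := by
  obtain ⟨e, he⟩ := MvPolynomial.support_nonempty.mpr (resForm_ne_zero ho hr)
  have hdeg : e.degree = o - s.r.degree := by
    have := resForm_isHomogeneous ho (MvPolynomial.mem_support_iff.mp he)
    rwa [weight_one_eq_degree] at this
  rw [← hdeg, Finsupp.degree_eq_sum]
  refine Finset.dvd_sum fun i _ => ?_
  exact (CharP.cast_eq_zero_iff K p (e i)).mp
    (natCast_apply_eq_zero_of_pderiv_eq_zero (pderiv_resForm_eq_zero_of_resVertex_eq_top htop i) he)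

/-- `e_G = 4` as a rank statement: `finrank (resVertex s) = 4 ⇒ resVertex s = ⊤`. [folklore] -/
theorem resVertex_eq_top_of_finrank_eq_four {s : State K} (h : Module.finrank K (resVertex s) = 4) :
    resVertex s = ⊤ :=
  Submodule.eq_top_of_finrank_eq (by rw [h, Module.finrank_fin_fun])

/-- Arithmetic of the band: `1 ≤ d ≤ 2p − 2` and `p ∣ d` force `d = p`. [folklore] -/
theorem eq_of_dvd_of_band {p d : ℕ} (hp : 2 ≤ p) (hd1 : 1 ≤ d) (hd2 : d ≤ 2 * p - 2) (hdvd : p ∣ d) :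
    d = p := by
  obtain ⟨k, rfl⟩ := hdvd
  rcases Nat.lt_or_ge k 2 with hk | hk
  · interval_cases k <;> omega
  · have : p * 2 ≤ p * k := Nat.mul_le_mul_left p hk
    omega

/-- **The `e_G = 4` slice of a constant-shade trap sits at `d = p`**: along an isolated `Step0 p` chain with
`x^{r₀} ∣ F₀`, if at some index the polar kernel is everything then the (natural) shade there is `0` or `p`;
with FILE 3e (`d ≠ 0`) a constant-`(d, e_G = 4)` trap has `d = p` and `g ∈ K[x₀^p, …, x₃^p]` homogeneous of
degree `p`, i.e. `g = Σ cᵢ xᵢ^p`. [OURS] [folklore] -/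
theorem shade_eq_zero_or_eq_of_resVertex_eq_top (p : ℕ) [Fact p.Prime] [CharP K p] [DecidableEq K]
    {c : ℕ → State K} (hc : ∀ k, IsIsolated p (c k).F ∧ Step0 p (c k) (c (k + 1)))
    (hr0 : ∀ e ∈ (c 0).F.support, (c 0).r ≤ e) (k : ℕ) (htop : resVertex (c k) = ⊤) :
    (c k).shade = 0 ∨ (c k).shade = (p : ℕ∞) := by
  have hp : 2 ≤ p := (Fact.out : p.Prime).two_le
  obtain ⟨o, ho, hpo, ho2⟩ := BandShade.exists_ordZero_eq p hc k
  have hr := IsolatedBand.isolated_chain_forall_le hc hr0 k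
  have hdvd := dvd_shade_of_resVertex_eq_top p ho hr htop
  rw [BandShade.shade_eq_coe ho]
  by_cases h0 : o - (c k).r.degree = 0
  · left; rw [h0]; rfl
  · right
    have := eq_of_dvd_of_band hp (Nat.one_le_iff_ne_zero.mpr h0) (by omega) hdvd
    rw [this]

end ResCone

end Summit.ResolutionOfSingularities.ResolutionOfSingularities.Theorems.PIDim4

end
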